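import Summits.ValiantsHypothesis.ValiantsHypothesis.Theorems.ProjectionStabilityOptStepTwoSidedTorusRestricted
import Summits.ValiantsHypothesis.ValiantsHypothesis.Theorems.ProjectionStabilityOptStepStubEvalPermPerPoly
import Summits.ValiantsHypothesis.ValiantsHypothesis.Theorems.ProjectionStabilityOptStepStubCoverCount
import Literature.Computability.AlgebraicComplexity.LandsbergRessayreProofs
import Literature.Computability.AlgebraicComplexity.GrenetEquivariant
import HarnessLib

/-!
# Two-sided-torus lower bound for `per_m` — IV: `edc_{T²}(per_m) ≥ 2^m − 1` (stub K2)

Closes the registered stub K2 `stub_twoSidedTorus_lower` of crux `ProjectionStability.OptStep`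
(stmt-ValiantsHypothesis-17835), line `Sketch`:

**Theorem.** Let `m ≥ 3` and let `A` be an `N × N` affine determinantal representation of `per_m`
over `ℂ` which is equivariant — exact lifts `A(γ·x) = g A(x) h⁻¹` — for the two-sided torus
`{X (i,j) ↦ d i * e j * X (i,j)}` (the subgroup of `GL(m²)` of `Grenet.isEquivariantDetRepr_repr`).
Then `N ≥ 2^m − 1`.  With `Grenet.hasEquivariantDetRepr_perPoly_twoSidedTorus` (size `2^m − 1`) this
is `edc_{T²}(per_m) = 2^m − 1`: Landsberg–Ressayre's Thm 2.8 WITHOUT the permutation half of the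
symmetry group (LR assume the left torus ⋊ `𝔖_m`; here both tori, no permutation).

**Proof.**  Regularity (`rank A(0) = N − 1`, von zur Gathen, tree) makes `ker Λ` a line.  ONE torus
element `τ = diag(p) ⊗ diag(q)` with `2m` distinct primes is lifted to `(g, h)`; for every
permutation `π` the RESTRICTED pencil `Λ + Σ_k y_k A_{k,π k}` (variables on the support of `P_π`
only) is again regular with the invertible member `A(P_π)` (`per(P_π) = 1`, stub H1) and carries the
lifted torus element with multipliers `p_k q_{π k}`; the general-multiplier LR §6 machinery (files
I–III) gives an exponent `u^π ≠ 0` whose weight `γ₀ ∏_k (p_k q_{π k})^{u_k}` is the TOP weight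
`β_top` of `g` on `ℂᴺ / range Λ` (common to all `π`), and then weights of every support size below
`|supp u^π|`.  Unique factorisation reads off from a weight the pair (row exponents, column
exponents) `= (u, u ∘ π⁻¹)`; comparing `π` with `π ∘ (k₀ k₁)` shows `supp u^π = [m]`.  At level `s`
the pairs `(v, v ∘ π⁻¹)`, `|supp v| = s`, take `≥ C(m,s)` values (covering count, stub H2), so `g`
has `≥ Σ_{s=1}^{m−1} C(m,s) = 2^m − 2` distinct non-top weights plus `β_top`, each with a non-zero
generalised eigenspace: `N ≥ 2^m − 1`.

## References
* J. M. Landsberg, N. Ressayre, arXiv:1508.05788, Thm 2.8 and §6 (method; permutation hypothesis removed here).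
* J. von zur Gathen, LAA 96 (1987) Thm 3.1 (regularity; tree `vonzurGathen1987_perm_detRepr_rank_holds`).
-/

noncomputable section

set_option linter.dupNamespace false

namespace Summit.ValiantsHypothesis.ValiantsHypothesis.Theorems.ProjectionStabilityOptStep.TwoSidedTorusLower

open Matrix MvPolynomial Finset Submodule Module.End
open Literature.Computability.AlgebraicComplexity LRPencil
open Summit.ValiantsHypothesis.ValiantsHypothesis.Theorems.ProjectionStabilityOptStep TwoSidedTorusRestricted

/-! ### The theorem -/

section Main

/-- **K2 — `edc_{T²}(per_m) ≥ 2^m − 1`** (registered stub `stub_twoSidedTorus_lower` of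
stmt-ValiantsHypothesis-17835): for `m ≥ 3`, every two-sided-torus-equivariant affine determinantal
representation of `per_m` over `ℂ` has size `N ≥ 2^m − 1`.  See the module docstring for the proof.
[cite: LandsbergRessayre2017, Thm 2.8 (method of §6)] -/
theorem stub_twoSidedTorus_lower :
    ∀ m : ℕ, 3 ≤ m → ∀ (N : ℕ) (A : Matrix (Fin N) (Fin N) (MvPolynomial (Fin m × Fin m) ℂ)),
      IsEquivariantDetRepr
        (Subgroup.closure {γ : GL (Fin m × Fin m) ℂ | ∃ d e : Fin m → ℂ,
          (γ : Matrix (Fin m × Fin m) (Fin m × Fin m) ℂ) = Matrix.diagonal (fun p => d p.1 * e p.2)})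
        (perPoly (Fin m) ℂ) A → 2 ^ m - 1 ≤ N := by
  intro m hm N A hA
  classical
  have haff : ∀ r c, (A r c).totalDegree ≤ 1 := hA.1.1
  have hdet : A.det = perPoly (Fin m) ℂ := hA.1.2
  have hm1 : 1 ≤ m := by omega
  -- `2m` distinct primes
  set P : Fin (m + m) → ℕ := fun i => Nat.nth Nat.Prime i with hPdef
  have hprime : ∀ i, (P i).Prime := fun i => Nat.prime_nth_prime _
  have hPinj : Function.Injective P := fun _ _ hab =>
    Fin.ext (Nat.nth_injective Nat.infinite_setOf_prime hab)
  have hP0 : ∀ i, (P i : ℂ) ≠ 0 := fun i => Nat.cast_ne_zero.2 (hprime i).ne_zero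
  set d : Fin m → ℂ := fun k => (P (Fin.castAdd m k) : ℂ) with hddef
  set e : Fin m → ℂ := fun j => (P (Fin.natAdd m j) : ℂ) with hedef
  have hde : ∀ v : Fin m × Fin m, d v.1 * e v.2 ≠ 0 := fun v => mul_ne_zero (hP0 _) (hP0 _)
  -- the torus element and its exact lift
  have hτ : Grenet.diagUnit (fun v : Fin m × Fin m => d v.1 * e v.2) hde ∈
      Subgroup.closure {γ : GL (Fin m × Fin m) ℂ | ∃ d e : Fin m → ℂ,
        (γ : Matrix (Fin m × Fin m) (Fin m × Fin m) ℂ) = Matrix.diagonal (fun p => d p.1 * e p.2)} :=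
    Subgroup.subset_closure ⟨d, e, rfl⟩
  obtain ⟨g, h, hgh, hΛ⟩ := hA.exists_lift_stabilising hτ
  set Λm : Matrix (Fin N) (Fin N) ℂ := constPart A with hΛm
  set Am : Fin m → Fin m → Matrix (Fin N) (Fin N) ℂ := fun k j => coeffMat A (k, j) with hAm
  have hAt : ∀ k j, (g : Matrix (Fin N) (Fin N) ℂ) * Am k j =
      (d k * e j) • (Am k j * (h : Matrix (Fin N) (Fin N) ℂ)) := by
    intro k j
    have e1 : coeffMat (Matrix.linSubstEntries (Grenet.diagUnit (fun v : Fin m × Fin m => d v.1 * e v.2) hde) A) (k, j) =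
        coeffMat ((g : Matrix (Fin N) (Fin N) ℂ).map C * A *
          ((h⁻¹ : GL (Fin N) ℂ) : Matrix (Fin N) (Fin N) ℂ).map C) (k, j) := by rw [hgh]
    rw [coeffMat_linSubstEntries _ _ haff, Grenet.val_diagUnit, sum_diagonal_smul,
      coeffMat_C_mul_mul_C] at e1
    rw [mul_eq_of_eq_mul_mul_inv e1, Matrix.smul_mul]
  -- regularity: `ker Λ` is a line
  have hreg : Λm.rank = N - 1 :=
    (isRegularDetRepr_perPoly vonzurGathen1987_perm_detRepr_rank_holds hm hA.1).2
  have hN : 1 ≤ N := by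
    rcases Nat.eq_zero_or_pos N with h0 | h0
    · subst h0
      exfalso
      have h3 : A.det = 1 := Matrix.det_isEmpty
      have h4 := congrArg constantCoeff hdet
      rw [h3, constantCoeff_perPoly ℂ hm1, map_one] at h4
      exact one_ne_zero h4
    · exact h0
  have hK : Module.finrank ℂ (LinearMap.ker (Matrix.toLin' Λm)) = 1 := by
    have h1 := LinearMap.finrank_range_add_finrank_ker (Matrix.toLin' Λm)
    rw [Module.finrank_fin_fun] at h1
    have h2 : Module.finrank ℂ (LinearMap.range (Matrix.toLin' Λm)) = N - 1 := by
      rw [Matrix.toLin'_apply']; exact hreg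
    omega
  have hK0 : LinearMap.ker (Matrix.toLin' Λm) ≠ ⊥ := by
    intro h0; rw [h0, finrank_bot] at hK; exact zero_ne_one hK
  -- the eigenvalue `γ₀` of `h` on `ker Λ`
  have hCker : (LinearMap.ker (Matrix.toLin' Λm)).map
      ((Matrix.toLinearEquiv' (h : Matrix (Fin N) (Fin N) ℂ) (Units.invertible h) :
        (Fin N → ℂ) ≃ₗ[ℂ] (Fin N → ℂ)) : (Fin N → ℂ) →ₗ[ℂ] (Fin N → ℂ)) = LinearMap.ker (Matrix.toLin' Λm) :=
    (liftOfMatrices Λm (fun _ _ : Fin 0 => (0 : Matrix (Fin N) (Fin N) ℂ)) 1 (fun _ => 1)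
      (fun _ => one_ne_zero) g h hΛ (fun k _ => k.elim0)).map_ker_eq
  obtain ⟨γ₀, hγ₀, hγker⟩ := exists_eigenvalue_of_finrank_ker_eq_one _ _ hCker hK
  replace hγker : LinearMap.ker (Matrix.toLin' Λm) ≤
      maxGenEigenspace (Matrix.toLin' (h : Matrix (Fin N) (Fin N) ℂ)) γ₀ := hγker
  -- the weights
  have hWT : Function.Injective fun U : Fin (m + m) → ℕ => γ₀ * ∏ i, (P i : ℂ) ^ U i :=
    mul_prod_pow_injective P hprime hPinj hγ₀
  have hwt_eq : ∀ (π : Equiv.Perm (Fin m)) (u : Fin m → ℕ),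
      γ₀ * ∏ k, (d k * e (π k)) ^ u k = γ₀ * ∏ i, (P i : ℂ) ^ (Fin.append u (u ∘ ⇑π.symm)) i := by
    intro π u; rw [prod_pair_pow_eq_append P π u]
  have hwinj : ∀ π : Equiv.Perm (Fin m),
      Function.Injective fun u : Fin m → ℕ => γ₀ * ∏ k, (d k * e (π k)) ^ u k := by
    intro π u u' huu
    have huu' : γ₀ * ∏ i, (P i : ℂ) ^ (Fin.append u (u ∘ ⇑π.symm)) i =
        γ₀ * ∏ i, (P i : ℂ) ^ (Fin.append u' (u' ∘ ⇑π.symm)) i := by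
      rw [← hwt_eq, ← hwt_eq]; exact huu
    exact (append_inj (hWT huu')).1
  -- an invertible member of each restricted pencil: `A(P_π)`, `det = per(P_π) = 1`
  have hgen : ∀ π : Equiv.Perm (Fin m), ∃ x : Fin m → Fin m → ℂ, Function.Injective
      (Matrix.toLin' Λm + ∑ k, ∑ j, x k j • Matrix.toLin' (if j = π k then Am k j else 0)) := by
    intro π
    let v : Fin m × Fin m → ℂ := fun w => if w.2 = π w.1 then 1 else 0
    refine ⟨fun k j => v (k, j), ?_⟩
    have hmat : Matrix.toLin' Λm + ∑ k, ∑ j, v (k, j) • Matrix.toLin' (if j = π k then Am k j else 0) =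
        Matrix.toLin' (A.map (MvPolynomial.eval v)) := by
      rw [map_eval_eq A haff v, map_add, map_sum, Fintype.sum_prod_type]
      congr 1
      refine sum_congr rfl fun k _ => ?_
      refine sum_congr rfl fun j _ => ?_
      rw [map_smul]
      by_cases hj : j = π k
      · simp only [v, if_pos hj, hAm]
      · simp only [v, if_neg hj, zero_smul]
    have hdetv : (A.map (MvPolynomial.eval v)).det ≠ 0 := by
      have e1 : (A.map (MvPolynomial.eval v)).det = MvPolynomial.eval v A.det := by
        rw [RingHom.map_det]; rfl
      rw [e1, hdet, EvalPermPerPoly.stub_eval_perm_perPoly m π]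
      exact one_ne_zero
    rw [hmat]
    have hunit : IsUnit (A.map (MvPolynomial.eval v)) :=
      (Matrix.isUnit_iff_isUnit_det _).2 (isUnit_iff_ne_zero.2 hdetv)
    intro x y hxy
    apply Matrix.mulVec_injective_iff_isUnit.2 hunit
    simpa [Matrix.toLin'_apply] using hxy
  -- the top weight and, for every `π`, the top exponent and the chain
  obtain ⟨βt, hβt⟩ := exists_isTop Λm g h hΛ hK
  have facts : ∀ π : Equiv.Perm (Fin m), ∃ u : Fin m → ℕ, u ≠ 0 ∧
      γ₀ * ∏ k, (d k * e (π k)) ^ u k = βt ∧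
      ∀ s, 1 ≤ s → s ≤ (supp u).card → ∃ v : Fin m → ℕ, (supp v).card = s ∧
        maxGenEigenspace (Matrix.toLin' (g : Matrix (Fin N) (Fin N) ℂ)) (γ₀ * ∏ k, (d k * e (π k)) ^ v k) ≠ ⊥ :=
    fun π => restricted_facts Λm Am g h hΛ (fun k j => d k * e j) (fun k j => hde (k, j)) hAt γ₀ hγker
      hK0 π (hwinj π) (hgen π) hβt
  choose ut hut0 huttop hchain using facts
  -- the top exponents have FULL support (swap argument across `π`)
  have hpair : ∀ π π' : Equiv.Perm (Fin m), ut π = ut π' ∧ ut π ∘ ⇑π.symm = ut π' ∘ ⇑π'.symm := by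
    intro π π'
    apply append_inj
    apply hWT
    show γ₀ * ∏ i, (P i : ℂ) ^ (Fin.append (ut π) (ut π ∘ ⇑π.symm)) i =
      γ₀ * ∏ i, (P i : ℂ) ^ (Fin.append (ut π') (ut π' ∘ ⇑π'.symm)) i
    rw [← hwt_eq, ← hwt_eq, huttop, huttop]
  have hfull : ∀ (π : Equiv.Perm (Fin m)) (k : Fin m), ut π k ≠ 0 := by
    intro π k₀ hk₀
    obtain ⟨k₁, hk₁⟩ : ∃ k₁, ut π k₁ ≠ 0 := by
      by_contra hall
      push Not at hall
      exact hut0 π (funext hall)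
    set π' : Equiv.Perm (Fin m) := π * Equiv.swap k₀ k₁ with hπ'
    obtain ⟨h1, h2⟩ := hpair π π'
    have key := congrFun h2 (π k₁)
    simp only [Function.comp_apply, Equiv.symm_apply_apply] at key
    rw [← h1] at key
    have hπ'k : π'.symm (π k₁) = k₀ := by
      rw [Equiv.symm_apply_eq, hπ', Equiv.Perm.mul_apply, Equiv.swap_apply_left]
    rw [hπ'k] at key
    exact hk₁ (key.trans hk₀)
  have hcard : ∀ π : Equiv.Perm (Fin m), (supp (ut π)).card = m := by
    intro π
    have : supp (ut π) = univ := by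
      ext k; simp only [supp, mem_filter, mem_univ, true_and, iff_true]; exact hfull π k
    rw [this, card_univ, Fintype.card_fin]
  -- the labels of level `s`
  have hlev : ∀ (s : ℕ) (π : Equiv.Perm (Fin m)), 1 ≤ s → s ≤ m → ∃ v : Fin m → ℕ, (supp v).card = s ∧
      maxGenEigenspace (Matrix.toLin' (g : Matrix (Fin N) (Fin N) ℂ)) (γ₀ * ∏ k, (d k * e (π k)) ^ v k) ≠ ⊥ :=
    fun s π hs1 hs => hchain π s hs1 (by rw [hcard π]; exact hs)
  choose! lab hlabcard hlabne using hlev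
  -- weights of level `s`, as a finset
  let W : ℕ → Finset ℂ := fun s => univ.image fun π : Equiv.Perm (Fin m) => γ₀ * ∏ k, (d k * e (π k)) ^ lab s π k
  have hWcard : ∀ s, 1 ≤ s → s < m → m.choose s ≤ (W s).card := by
    intro s hs1 hs
    have hcov := CoverCount.stub_coverCount m s (lab s) (fun π => hlabcard s π hs1 hs.le)
    refine hcov.trans (le_of_eq ?_)
    have hWimg : W s = (univ.image fun π : Equiv.Perm (Fin m) => (lab s π, lab s π ∘ ⇑π.symm)).image
        (fun ab : (Fin m → ℕ) × (Fin m → ℕ) => γ₀ * ∏ i, (P i : ℂ) ^ (Fin.append ab.1 ab.2) i) := by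
      rw [Finset.image_image]
      refine Finset.image_congr fun π _ => ?_
      simp only [Function.comp_apply]
      exact hwt_eq π (lab s π)
    have hinjf : Function.Injective
        (fun ab : (Fin m → ℕ) × (Fin m → ℕ) => γ₀ * ∏ i, (P i : ℂ) ^ (Fin.append ab.1 ab.2) i) := by
      rintro ⟨a, b⟩ ⟨a', b'⟩ hab
      obtain ⟨h1, h2⟩ := append_inj (hWT hab)
      simp only at h1 h2
      rw [h1, h2]
    rw [hWimg, Finset.card_image_of_injective _ hinjf]
  -- reading off the level from a weight
  have hread : ∀ s s' (π π' : Equiv.Perm (Fin m)), 1 ≤ s → s ≤ m → 1 ≤ s' → s' ≤ m →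
      γ₀ * ∏ k, (d k * e (π k)) ^ lab s π k = γ₀ * ∏ k, (d k * e (π' k)) ^ lab s' π' k → s = s' := by
    intro s s' π π' hs1 hs hs1' hs' heq
    rw [hwt_eq, hwt_eq] at heq
    have h1 := (append_inj (hWT heq)).1
    rw [← hlabcard s π hs1 hs, ← hlabcard s' π' hs1' hs', h1]
  have hdisj : ((Ico 1 m : Finset ℕ) : Set ℕ).PairwiseDisjoint W := by
    intro s hs s' hs' hne
    rw [Function.onFun, Finset.disjoint_left]
    intro β hβ hβ'
    simp only [W, Finset.mem_image, mem_univ, true_and] at hβ hβ'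
    obtain ⟨π, rfl⟩ := hβ
    obtain ⟨π', hπ'⟩ := hβ'
    have hsI := Finset.mem_Ico.1 hs
    have hsI' := Finset.mem_Ico.1 hs'
    exact hne (hread s s' π π' hsI.1 hsI.2.le hsI'.1 hsI'.2.le hπ'.symm)
  have htop_notin : ∀ s ∈ Ico 1 m, βt ∉ W s := by
    intro s hs hmem
    simp only [W, Finset.mem_image, mem_univ, true_and] at hmem
    obtain ⟨π, hπ⟩ := hmem
    have hsI := Finset.mem_Ico.1 hs
    rw [← huttop π, hwt_eq, hwt_eq] at hπ
    have h1 := (append_inj (hWT hπ)).1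
    have := hlabcard s π hsI.1 hsI.2.le
    rw [h1, hcard π] at this
    omega
  -- all these weights have non-zero generalised eigenspaces of `g`
  set Wall : Finset ℂ := insert βt ((Ico 1 m).biUnion W) with hWall
  have hne : ∀ β ∈ Wall, maxGenEigenspace (Matrix.toLin' (g : Matrix (Fin N) (Fin N) ℂ)) β ≠ ⊥ := by
    intro β hβ
    rw [Finset.mem_insert] at hβ
    rcases hβ with hβ | hβ
    · -- the top weight: if `E βt = ⊥` then ALL weight spaces of `g` lie in `range Λ`, so
      -- `range Λ = ℂᴺ`, contradicting `dim ker Λ = 1`.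
      rw [hβ]
      intro hbot
      have hall : ∀ β, maxGenEigenspace (Matrix.toLin' (g : Matrix (Fin N) (Fin N) ℂ)) β ≤
          LinearMap.range (Matrix.toLin' Λm) := by
        intro β
        by_cases hb : β = βt
        · rw [hb, hbot]; exact bot_le
        · exact hβt β hb
      have htop' : (⊤ : Submodule ℂ (Fin N → ℂ)) ≤ LinearMap.range (Matrix.toLin' Λm) := by
        rw [← Module.End.iSup_maxGenEigenspace_eq_top (Matrix.toLin' (g : Matrix (Fin N) (Fin N) ℂ))]
        exact iSup_le hall
      have hrange : Module.finrank ℂ (LinearMap.range (Matrix.toLin' Λm)) = N := by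
        rw [eq_top_iff.2 htop', finrank_top, Module.finrank_fin_fun]
      have h1 := LinearMap.finrank_range_add_finrank_ker (Matrix.toLin' Λm)
      rw [Module.finrank_fin_fun, hrange, hK] at h1
      omega
    · rw [Finset.mem_biUnion] at hβ
      obtain ⟨s, hs, hβs⟩ := hβ
      simp only [W, Finset.mem_image, mem_univ, true_and] at hβs
      obtain ⟨π, rfl⟩ := hβs
      have hsI := Finset.mem_Ico.1 hs
      exact hlabne s π hsI.1 hsI.2.le
  -- count
  have hWall_card : 2 ^ m - 1 ≤ Wall.card := by
    have hnot : βt ∉ (Ico 1 m).biUnion W := by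
      rw [Finset.mem_biUnion]; rintro ⟨s, hs, hmem⟩; exact htop_notin s hs hmem
    rw [hWall, Finset.card_insert_of_notMem hnot, Finset.card_biUnion hdisj]
    have hsum : ∑ s ∈ Ico 1 m, m.choose s ≤ ∑ s ∈ Ico 1 m, (W s).card :=
      Finset.sum_le_sum fun s hs => by
        have hsI := Finset.mem_Ico.1 hs
        exact hWcard s hsI.1 hsI.2
    rw [sum_Ico_choose m hm1] at hsum
    have h2m : 2 ≤ 2 ^ m := by
      calc 2 = 2 ^ 1 := by norm_num
        _ ≤ 2 ^ m := Nat.pow_le_pow_right (by norm_num) hm1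
    omega
  -- independence of the generalised eigenspaces of `g`
  have hind : iSupIndep (fun β : Wall =>
      maxGenEigenspace (Matrix.toLin' (g : Matrix (Fin N) (Fin N) ℂ)) (β : ℂ)) :=
    (Module.End.independent_maxGenEigenspace _).comp Subtype.val_injective
  have hne' : ∀ β : Wall, (fun β : Wall =>
      maxGenEigenspace (Matrix.toLin' (g : Matrix (Fin N) (Fin N) ℂ)) (β : ℂ)) β ≠ ⊥ :=
    fun β => hne β.1 β.2
  have hfin := hind.subtype_ne_bot_le_finrank
  rw [Fintype.card_congr (Equiv.subtypeUnivEquiv hne'), Fintype.card_coe, Module.finrank_fin_fun] at hfin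
  exact hWall_card.trans hfin

end Main

end Summit.ValiantsHypothesis.ValiantsHypothesis.Theorems.ProjectionStabilityOptStep.TwoSidedTorusLower
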